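import Literature.NumberTheory.LFunctions.WeilTwoPrimeDeflM75YBase
import Literature.NumberTheory.LFunctions.WeilTwoPrimeDeflM75YDataR
import Literature.NumberTheory.LFunctions.WeilTwoPrimeCellsT120
import Literature.NumberTheory.LFunctions.WeilTwoPrimeCertificateDeflated
import HarnessLib

/-!
# Deflated two-prime certificate M75Y: the certificate `weilCertDeflM75Y : WeilCert23` and its augmented coefficient matrix

`weilCertDeflM75Y` = base `weilCertDeflM75YBase` + `j = 5` + `pnu = 64` + the cells `weilTwoPrimeCellsT120` + support `b = 3/4` + the table `weilCertDeflM75YNu`; penalty data `weilCertDeflM75YR`; `weilCertDeflM75YP = P_r + Σ μ ĉ ĉᵀ`. [cite: Yoshida1992, §6, Thm 1 p. 310] Data only.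
-/

noncomputable section

namespace Summit.RiemannHypothesis.RiemannHypothesis.Theorems.EvenWinsBeyondArch

open Literature.NumberTheory.LFunctions

/-- **The deflated two-prime certificate M75Y** (`a₀ = b = 3/4`, `N = 255`, `T = 120`, `β₂₃ = 17/25`, k_odd = 6). [folklore] -/
def weilCertDeflM75Y : WeilCert23 := ⟨weilCertDeflM75YBase, 5, 64, weilTwoPrimeCellsT120, 3/4, weilCertDeflM75YNu⟩

/-- The base of `weilCertDeflM75Y` is `weilCertDeflM75YBase` (definitional). [folklore] -/
theorem weilCertDeflM75Y_base : weilCertDeflM75Y.base = weilCertDeflM75YBase := rfl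

/-- The table of `weilCertDeflM75Y` is `weilCertDeflM75YNu` (definitional). [folklore] -/
theorem weilCertDeflM75Y_nuTab : weilCertDeflM75Y.nuTab = weilCertDeflM75YNu := rfl

/-- The augmented coefficient matrix `P_r + Σ μ ĉ ĉᵀ` of certificate M75Y. [folklore] -/
def weilCertDeflM75YP (k l : ℕ) : ℚ := weilCertDeflM75YBase.prQ weilCertDeflM75YNu k l + rankOneQ weilCertDeflM75YR k l

/-- `weilCertDeflM75YP` is the augmented matrix of the certificate (definitional). [folklore] -/
theorem weilCertDeflM75YP_eq : weilCertDeflM75YP = fun k l ↦ weilCertDeflM75Y.base.prQ weilCertDeflM75Y.nuTab k l + rankOneQ weilCertDeflM75YR k l := rfl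

end Summit.RiemannHypothesis.RiemannHypothesis.Theorems.EvenWinsBeyondArch
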